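import Literature.Analysis.TotalPositivity.PolyaFrequencyPolynomials
import Literature.Analysis.TotalPositivity.PolyaFrequencySmoothing
import Mathlib.MeasureTheory.Group.Prod
import Mathlib.MeasureTheory.Integral.Prod
import HarnessLib

/-!
# The variation diminishing property of `Λ ⋆` on polynomials, by Gaussian smoothing
(Schoenberg 1951, necessity half, step N3b)

Trunk `Literature/Analysis/TotalPositivity`, thirteenth proofs file accompanying
`PolyaFrequencyFunctions.lean` (the named fact `schoenberg1951_pf_laplace`).  For a Pólya
frequency function `Λ` and a real polynomial `f ≠ 0` all of whose real roots lie among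
`r₀ < ⋯ < r_{m−1}`, the transform `T f = Σ_k c_k H_k f` (`c_k = ∫(−t)^kΛ`,
`PolyaFrequencyPolynomials.lean`), i.e. `(T f)(x) = ∫ Λ(t) f(x − t) dt`, does not alternate
strictly in sign at any `m + 2` increasing points (`IsPolyaFrequencyFun.no_alternation_hasseSum`).

Proof: for the strictly totally positive smoothed kernels `K_a = φ_a ⋆ (Λ ⋆ φ_a)`
(`PolyaFrequencySmoothing.lean`) this is the variation diminishing property
(`no_alternation_of_strict_tp`, PolyaFrequencyVariationDiminishing.lean); by two applications of a
Fubini identity for `∫ (k₁ ⋆ k₂)(x − t) f(t) dt` (`integral_conv_mul_eq`) one has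
`∫ K_a(x − t) f(t) dt = (Σ_k μ_k H_k T (Σ_j μ_j H_j f))(x)` with the Gaussian moments
`μ_k = ∫ (−s)^k e^{−as²} ds`, and `μ_k/μ_0 → 0` (`k ≥ 1`) as `a → ∞`, so that
`μ_0^{-2} ∫ K_a(x − t) f(t) dt → (T f)(x)`; a strict alternation of `T f` would therefore be
inherited by `K_a ⋆ f` for large `a`.

## References

* I. J. Schoenberg, *On Pólya frequency functions. I*, J. Analyse Math. 1 (1951) 331–374, §§7–8.
  [Schoenberg1951]
* S. Karlin, *Total Positivity* I (1968), Ch. 5 §1, Ch. 7 §2. [Karlin1968]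
-/

noncomputable section

open MeasureTheory Set Filter Finset Polynomial
open scoped Topology Polynomial

namespace Literature.Analysis.TotalPositivity

/-! ### A Fubini identity for iterated convolutions against a function of exponential growth -/

/-- The shear `(r, t) ↦ (r, y − t − r)` preserves Lebesgue measure on `ℝ²`. [folklore] -/
theorem measurePreserving_shear (y : ℝ) :
    MeasurePreserving (fun p : ℝ × ℝ => (p.1, y - p.2 - p.1))
      ((volume : Measure ℝ).prod volume) ((volume : Measure ℝ).prod volume) := by
  have h1 : MeasurePreserving (fun p : ℝ × ℝ => (p.1, y - p.2))
      ((volume : Measure ℝ).prod volume) ((volume : Measure ℝ).prod volume) :=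
    (MeasurePreserving.id volume).prod ((volume : Measure ℝ).measurePreserving_sub_left y)
  exact (measurePreserving_prod_sub (volume : Measure ℝ) (volume : Measure ℝ)).comp h1

/-- **Fubini for `∫ (k₁ ⋆ k₂)(y − t) f(t) dt`.**  Let `k₁, k₂ ≥ 0` be measurable with
`k₁ e^{δ|·|}`, `k₂ e^{δ|·|}` integrable (`δ ≥ 0`), and `f` measurable with `|f(t)| ≤ A e^{δ|t|}`.
Then `(r, t) ↦ k₁(r) k₂(y − t − r) f(t)` is integrable on `ℝ²` and
`∫ (∫ k₁(r) k₂(y − t − r) dr) f(t) dt = ∫ k₁(r) (∫ k₂(y − r − t) f(t) dt) dr`. [folklore] -/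
theorem integral_conv_mul_eq {k₁ k₂ f : ℝ → ℝ} (hk₁m : Measurable k₁) (hk₂m : Measurable k₂)
    (hfm : Measurable f) (hk₁0 : ∀ w, 0 ≤ k₁ w) (hk₂0 : ∀ w, 0 ≤ k₂ w) {δ A : ℝ} (hδ : 0 ≤ δ)
    (hfA : ∀ t, |f t| ≤ A * Real.exp (δ * |t|))
    (hI₁ : Integrable fun r => k₁ r * Real.exp (δ * |r|))
    (hI₂ : Integrable fun w => k₂ w * Real.exp (δ * |w|)) (y : ℝ) :
    Integrable (fun p : ℝ × ℝ => k₁ p.1 * k₂ (y - p.2 - p.1) * f p.2)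
        ((volume : Measure ℝ).prod volume) ∧
      ∫ t, (∫ r, k₁ r * k₂ (y - t - r)) * f t = ∫ r, k₁ r * ∫ t, k₂ (y - r - t) * f t := by
  have hA0 : 0 ≤ A := by
    have := (abs_nonneg (f 0)).trans (hfA 0)
    simpa using this
  -- integrability on `ℝ²` by domination through the shear of a product
  set D : ℝ × ℝ → ℝ := fun p => A * Real.exp (δ * |y|) *
    ((k₁ p.1 * Real.exp (δ * |p.1|)) * (k₂ (y - p.2 - p.1) * Real.exp (δ * |y - p.2 - p.1|))) with hD
  have hDi : Integrable D ((volume : Measure ℝ).prod volume) := by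
    have hprod := hI₁.mul_prod hI₂
    have hcomp := (measurePreserving_shear y).integrable_comp_of_integrable hprod
    exact hcomp.const_mul (A * Real.exp (δ * |y|))
  have hGm : Measurable fun p : ℝ × ℝ => k₁ p.1 * k₂ (y - p.2 - p.1) * f p.2 :=
    ((hk₁m.comp measurable_fst).mul (hk₂m.comp ((measurable_const.sub measurable_snd).sub
      measurable_fst))).mul (hfm.comp measurable_snd)
  have hGi : Integrable (fun p : ℝ × ℝ => k₁ p.1 * k₂ (y - p.2 - p.1) * f p.2)
      ((volume : Measure ℝ).prod volume) := by
    refine hDi.mono' hGm.aestronglyMeasurable (Eventually.of_forall fun p => ?_)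
    rw [Real.norm_eq_abs, abs_mul, abs_mul, abs_of_nonneg (hk₁0 _), abs_of_nonneg (hk₂0 _), hD]
    have h1 := hfA p.2
    have habs : |p.2| ≤ |y| + |p.1| + |y - p.2 - p.1| := by
      have e : (y - p.1) - (y - p.2 - p.1) = p.2 := by ring
      calc |p.2| = |(y - p.1) - (y - p.2 - p.1)| := by rw [e]
        _ ≤ |y - p.1| + |y - p.2 - p.1| := abs_sub _ _
        _ ≤ |y| + |p.1| + |y - p.2 - p.1| := by linarith [abs_sub y p.1]
    have h2 : Real.exp (δ * |p.2|) ≤ Real.exp (δ * |y|) * Real.exp (δ * |p.1|) *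
        Real.exp (δ * |y - p.2 - p.1|) := by
      rw [← Real.exp_add, ← Real.exp_add, Real.exp_le_exp]
      nlinarith
    calc k₁ p.1 * k₂ (y - p.2 - p.1) * |f p.2|
        ≤ k₁ p.1 * k₂ (y - p.2 - p.1) * (A * Real.exp (δ * |p.2|)) :=
          mul_le_mul_of_nonneg_left h1 (mul_nonneg (hk₁0 _) (hk₂0 _))
      _ ≤ k₁ p.1 * k₂ (y - p.2 - p.1) * (A * (Real.exp (δ * |y|) * Real.exp (δ * |p.1|) *
          Real.exp (δ * |y - p.2 - p.1|))) :=
          mul_le_mul_of_nonneg_left (mul_le_mul_of_nonneg_left h2 hA0) (mul_nonneg (hk₁0 _) (hk₂0 _))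
      _ = A * Real.exp (δ * |y|) * ((k₁ p.1 * Real.exp (δ * |p.1|)) *
          (k₂ (y - p.2 - p.1) * Real.exp (δ * |y - p.2 - p.1|))) := by ring
  refine ⟨hGi, ?_⟩
  -- Fubini
  have hswap := integral_integral_swap (f := fun t r => k₁ r * k₂ (y - t - r) * f t) hGi.swap
  calc ∫ t, (∫ r, k₁ r * k₂ (y - t - r)) * f t = ∫ t, ∫ r, k₁ r * k₂ (y - t - r) * f t := by
        congr 1
        funext t
        rw [← integral_mul_const]
    _ = ∫ r, ∫ t, k₁ r * k₂ (y - t - r) * f t := hswap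
    _ = ∫ r, k₁ r * ∫ t, k₂ (y - r - t) * f t := by
        congr 1
        funext r
        rw [← integral_const_mul]
        congr 1
        funext t
        rw [show y - t - r = y - r - t by ring]
        ring

/-! ### Gaussian moments -/

/-- `|u|^k e^{−u²}` is integrable. [folklore] -/
theorem integrable_abs_pow_mul_gaussian (k : ℕ) :
    Integrable fun u : ℝ => |u| ^ k * Real.exp (-u ^ 2) := by
  have hint : Integrable fun u : ℝ => (Nat.factorial k : ℝ) * Real.exp (1 / 2) *
      Real.exp (-(1 / 2) * u ^ 2) := (integrable_exp_neg_mul_sq (by norm_num)).const_mul _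
  refine hint.mono' ((continuous_abs.pow k).mul (Real.continuous_exp.comp
    (continuous_pow 2).neg)).aestronglyMeasurable (Eventually.of_forall fun u => ?_)
  rw [Real.norm_eq_abs, abs_mul, abs_pow, abs_abs, abs_of_pos (Real.exp_pos _)]
  have h1 := abs_pow_le_factorial_mul_exp one_pos k u
  simp only [inv_one, one_pow, mul_one, one_mul] at h1
  have h2 : Real.exp |u| * Real.exp (-u ^ 2) ≤ Real.exp (1 / 2) * Real.exp (-(1 / 2) * u ^ 2) := by
    rw [← Real.exp_add, ← Real.exp_add, Real.exp_le_exp]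
    nlinarith [sq_nonneg (|u| - 1), sq_abs u]
  calc |u| ^ k * Real.exp (-u ^ 2) ≤ (Nat.factorial k : ℝ) * Real.exp |u| * Real.exp (-u ^ 2) :=
        mul_le_mul_of_nonneg_right h1 (Real.exp_pos _).le
    _ = (Nat.factorial k : ℝ) * (Real.exp |u| * Real.exp (-u ^ 2)) := by ring
    _ ≤ (Nat.factorial k : ℝ) * (Real.exp (1 / 2) * Real.exp (-(1 / 2) * u ^ 2)) :=
        mul_le_mul_of_nonneg_left h2 (by positivity)
    _ = (Nat.factorial k : ℝ) * Real.exp (1 / 2) * Real.exp (-(1 / 2) * u ^ 2) := by ring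

/-- **Scaling bound for the Gaussian moments**:
`|∫ (−s)^k e^{−as²} ds| ≤ (√a)^{−(k+1)} ∫ |u|^k e^{−u²} du` (`a > 0`; substitute `u = √a s`).
[folklore] -/
theorem abs_integral_neg_pow_gaussian_le {a : ℝ} (ha : 0 < a) (k : ℕ) :
    |∫ s, (-s) ^ k * Real.exp (-a * s ^ 2)| ≤
      (Real.sqrt a)⁻¹ ^ (k + 1) * ∫ u, |u| ^ k * Real.exp (-u ^ 2) := by
  have hsa : 0 < Real.sqrt a := Real.sqrt_pos.2 ha
  set g : ℝ → ℝ := fun u => |u| ^ k * Real.exp (-u ^ 2) with hg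
  have hscale : ∀ s : ℝ, |s| ^ k * Real.exp (-a * s ^ 2) = (Real.sqrt a)⁻¹ ^ k * g (Real.sqrt a * s) := by
    intro s
    rw [hg]
    simp only
    rw [abs_mul, abs_of_pos hsa, mul_pow, mul_pow, Real.sq_sqrt ha.le]
    have : (Real.sqrt a)⁻¹ ^ k * (Real.sqrt a) ^ k = 1 := by
      rw [← mul_pow, inv_mul_cancel₀ hsa.ne', one_pow]
    calc |s| ^ k * Real.exp (-a * s ^ 2) = ((Real.sqrt a)⁻¹ ^ k * (Real.sqrt a) ^ k) *
        (|s| ^ k * Real.exp (-a * s ^ 2)) := by rw [this, one_mul]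
      _ = (Real.sqrt a)⁻¹ ^ k * ((Real.sqrt a) ^ k * |s| ^ k * Real.exp (-(a * s ^ 2))) := by ring
  calc |∫ s, (-s) ^ k * Real.exp (-a * s ^ 2)|
      ≤ ∫ s, |(-s) ^ k * Real.exp (-a * s ^ 2)| := by
        have := norm_integral_le_integral_norm (μ := volume) (fun s : ℝ => (-s) ^ k * Real.exp (-a * s ^ 2))
        simpa [Real.norm_eq_abs] using this
    _ = ∫ s, (Real.sqrt a)⁻¹ ^ k * g (Real.sqrt a * s) := by
        congr 1
        funext s
        rw [abs_mul, abs_pow, abs_neg, abs_of_pos (Real.exp_pos _)]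
        exact hscale s
    _ = (Real.sqrt a)⁻¹ ^ k * ((Real.sqrt a)⁻¹ * ∫ u, g u) := by
        rw [integral_const_mul, Measure.integral_comp_mul_left g (Real.sqrt a),
          abs_of_pos (inv_pos.2 hsa), smul_eq_mul]
    _ = (Real.sqrt a)⁻¹ ^ (k + 1) * ∫ u, |u| ^ k * Real.exp (-u ^ 2) := by
        rw [pow_succ]
        ring

/-- The zeroth Gaussian moment: `∫ (−s)^0 e^{−as²} ds = √(π/a)`. [folklore] -/
theorem integral_pow_zero_gaussian (a : ℝ) :
    ∫ s, (-s) ^ 0 * Real.exp (-a * s ^ 2) = Real.sqrt (Real.pi / a) := by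
  simp only [pow_zero, one_mul]
  exact integral_gaussian a

/-- **The normalised Gaussian moments vanish in the limit**: for `k ≥ 1`,
`(∫ (−s)^k e^{−as²} ds) / (∫ e^{−as²} ds) → 0` as `a → ∞`. [folklore] -/
theorem tendsto_gaussian_moment_ratio {k : ℕ} (hk : 1 ≤ k) :
    Tendsto (fun a : ℝ => (∫ s, (-s) ^ k * Real.exp (-a * s ^ 2)) /
      (∫ s, (-s) ^ 0 * Real.exp (-a * s ^ 2))) atTop (𝓝 0) := by
  set I : ℝ := ∫ u, |u| ^ k * Real.exp (-u ^ 2) with hI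
  have hI0 : 0 ≤ I := integral_nonneg fun u => mul_nonneg (pow_nonneg (abs_nonneg _) _) (Real.exp_pos _).le
  -- bound: `|ratio| ≤ (I/√π) (√a)⁻¹` for `a ≥ 1`
  have hbound : ∀ a : ℝ, 1 ≤ a → |(∫ s, (-s) ^ k * Real.exp (-a * s ^ 2)) /
      (∫ s, (-s) ^ 0 * Real.exp (-a * s ^ 2))| ≤ I / Real.sqrt Real.pi * (Real.sqrt a)⁻¹ := by
    intro a ha1
    have ha : 0 < a := lt_of_lt_of_le one_pos ha1
    have hsa : 0 < Real.sqrt a := Real.sqrt_pos.2 ha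
    have hsa1 : 1 ≤ Real.sqrt a := by
      rw [← Real.sqrt_one]
      exact Real.sqrt_le_sqrt ha1
    rw [integral_pow_zero_gaussian, abs_div, abs_of_pos (Real.sqrt_pos.2 (div_pos Real.pi_pos ha)),
      div_le_iff₀ (Real.sqrt_pos.2 (div_pos Real.pi_pos ha))]
    refine (abs_integral_neg_pow_gaussian_le ha k).trans ?_
    rw [Real.sqrt_div Real.pi_pos.le, pow_succ]
    have hpi : 0 < Real.sqrt Real.pi := Real.sqrt_pos.2 Real.pi_pos
    have hk' : (Real.sqrt a)⁻¹ ^ k ≤ (Real.sqrt a)⁻¹ := by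
      calc (Real.sqrt a)⁻¹ ^ k ≤ (Real.sqrt a)⁻¹ ^ 1 :=
            pow_le_pow_of_le_one (inv_nonneg.2 hsa.le) (inv_le_one_of_one_le₀ hsa1) hk
        _ = (Real.sqrt a)⁻¹ := pow_one _
    have h1 : (Real.sqrt a)⁻¹ ^ k * (Real.sqrt a)⁻¹ * I ≤ (Real.sqrt a)⁻¹ * (Real.sqrt a)⁻¹ * I :=
      mul_le_mul_of_nonneg_right (mul_le_mul_of_nonneg_right hk' (inv_nonneg.2 hsa.le)) hI0
    have h2 : I / Real.sqrt Real.pi * (Real.sqrt a)⁻¹ * (Real.sqrt Real.pi / Real.sqrt a) =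
        (Real.sqrt a)⁻¹ * (Real.sqrt a)⁻¹ * I := by
      field_simp
    linarith
  rw [tendsto_zero_iff_abs_tendsto_zero]
  have hlim : Tendsto (fun a : ℝ => I / Real.sqrt Real.pi * (Real.sqrt a)⁻¹) atTop (𝓝 0) := by
    have h := (tendsto_inv_atTop_zero.comp (Real.tendsto_sqrt_atTop)).const_mul (I / Real.sqrt Real.pi)
    simpa using h
  refine squeeze_zero' (Eventually.of_forall fun a => abs_nonneg _) ?_ hlim
  filter_upwards [eventually_ge_atTop (1 : ℝ)] with a ha using hbound a ha

/-! ### Integrability inputs -/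

/-- A Gaussian absorbs any exponential: `e^{−aw²} e^{δ|w|}` is integrable (`a > 0`). [folklore] -/
theorem integrable_gaussian_mul_exp_abs {a : ℝ} (ha : 0 < a) (δ : ℝ) :
    Integrable fun w : ℝ => Real.exp (-a * w ^ 2) * Real.exp (δ * |w|) := by
  have hint : Integrable fun w : ℝ => Real.exp (δ ^ 2 / (2 * a)) * Real.exp (-(a / 2) * w ^ 2) :=
    (integrable_exp_neg_mul_sq (half_pos ha)).const_mul _
  refine hint.mono' (by fun_prop) (Eventually.of_forall fun w => ?_)
  rw [Real.norm_eq_abs, abs_of_nonneg (by positivity), ← Real.exp_add, ← Real.exp_add, Real.exp_le_exp]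
  have hsq : |w| ^ 2 = w ^ 2 := sq_abs w
  have key : δ ^ 2 / (2 * a) + -(a / 2) * w ^ 2 - (-a * w ^ 2 + δ * |w|) =
      (a * |w| - δ) ^ 2 / (2 * a) := by
    rw [← hsq]
    field_simp
    ring
  have hpos : 0 ≤ (a * |w| - δ) ^ 2 / (2 * a) := by positivity
  linarith

/-- An exponentially decaying non-negative measurable function times a slower exponential is
integrable. [folklore] -/
theorem integrable_mul_exp_abs_of_decay {k : ℝ → ℝ} (hkm : Measurable k) (hk0 : ∀ w, 0 ≤ k w)
    {C η δ : ℝ} (hk : ∀ w, k w ≤ C * Real.exp (-(η * |w|))) (hδ : δ < η) :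
    Integrable fun w : ℝ => k w * Real.exp (δ * |w|) := by
  have hC0 : 0 ≤ C := by
    have := (hk0 0).trans (hk 0)
    simpa using this
  have hint : Integrable fun w : ℝ => C * Real.exp (-((η - δ) * |w|)) :=
    (integrable_exp_neg_mul_abs (by linarith)).const_mul C
  refine hint.mono' ((hkm.mul (by fun_prop)).aestronglyMeasurable) (Eventually.of_forall fun w => ?_)
  rw [Real.norm_eq_abs, abs_of_nonneg (mul_nonneg (hk0 w) (Real.exp_pos _).le)]
  calc k w * Real.exp (δ * |w|) ≤ C * Real.exp (-(η * |w|)) * Real.exp (δ * |w|) :=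
        mul_le_mul_of_nonneg_right (hk w) (Real.exp_pos _).le
    _ = C * Real.exp (-((η - δ) * |w|)) := by
        rw [mul_assoc, ← Real.exp_add]
        congr 2
        ring

/-! ### Linearity of the Hasse sums -/

/-- `Σ_k c_k H_k (s • g) = s • Σ_k c_k H_k g`. [folklore] -/
theorem hasseSum_smul_right (c : ℕ → ℝ) (n : ℕ) (s : ℝ) (g : ℝ[X]) :
    ∑ k ∈ Finset.range (n + 1), c k • Polynomial.hasseDeriv k (s • g) =
      s • ∑ k ∈ Finset.range (n + 1), c k • Polynomial.hasseDeriv k g := by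
  rw [Finset.smul_sum]
  refine Finset.sum_congr rfl fun k _ => ?_
  rw [LinearMap.map_smul_of_tower, smul_comm]

/-- `Σ_k (s c_k) H_k g = s • Σ_k c_k H_k g`. [folklore] -/
theorem hasseSum_smul_left (c : ℕ → ℝ) (n : ℕ) (s : ℝ) (g : ℝ[X]) :
    ∑ k ∈ Finset.range (n + 1), (s * c k) • Polynomial.hasseDeriv k g =
      s • ∑ k ∈ Finset.range (n + 1), c k • Polynomial.hasseDeriv k g := by
  rw [Finset.smul_sum]
  refine Finset.sum_congr rfl fun k _ => ?_
  rw [smul_smul]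

/-! ### The smoothed transform on a polynomial -/

/-- **The doubly smoothed transform of a polynomial**: for a Pólya frequency function `Λ`, `a > 0`,
`φ_a(u) = e^{−au²}`, `K_a(u) = ∫ φ_a(t) (∫ Λ(r) φ_a(u − t − r) dr) dt`, and a real polynomial `f`
with `deg f ≤ n`, one has for every `x`
`∫ K_a(x − t) f(t) dt = (Σ_k μ_k H_k Σ_i c_i H_i Σ_j μ_j H_j f)(x)`,
`μ_k = ∫ (−s)^k φ_a(s) ds`, `c_i = ∫ (−t)^i Λ(t) dt` (two Fubini identities and three Hasse
expansions). [cite: Schoenberg1951, §8] [folklore] -/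
theorem IsPolyaFrequencyFun.smoothing_transform_eval {Λ : ℝ → ℝ} (h : IsPolyaFrequencyFun Λ)
    {c : ℕ → ℝ} (hc : ∀ k, c k = ∫ t, (-t) ^ k * Λ t) {a : ℝ} (ha : 0 < a) {μ : ℕ → ℝ}
    (hμ : ∀ k, μ k = ∫ s, (-s) ^ k * Real.exp (-a * s ^ 2)) {n : ℕ} {f : ℝ[X]}
    (hf : f.natDegree ≤ n) (x : ℝ) :
    ∫ t, (fun u => ∫ t', Real.exp (-a * t' ^ 2) *
        (fun v => ∫ r, Λ r * Real.exp (-a * (v - r) ^ 2)) (u - t')) (x - t) * f.eval t =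
      (∑ k ∈ Finset.range (n + 1), μ k • Polynomial.hasseDeriv k
        (∑ i ∈ Finset.range (n + 1), c i • Polynomial.hasseDeriv i
          (∑ j ∈ Finset.range (n + 1), μ j • Polynomial.hasseDeriv j f))).eval x := by
  set φ : ℝ → ℝ := fun u => Real.exp (-a * u ^ 2) with hφdef
  have hφpf : IsPolyaFrequencyFun φ := by
    simpa [hφdef] using isPolyaFrequencyFun_gaussian ha one_pos
  have hφle : ∀ u, φ u ≤ 1 := fun u => Real.exp_le_one_iff.2 (by nlinarith [sq_nonneg u])
  have hμ' : ∀ k, μ k = ∫ s, (-s) ^ k * φ s := hμ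
  set H : ℝ → ℝ := fun v => ∫ r, Λ r * φ (v - r) with hHdef
  have hHpf : IsPolyaFrequencyFun H := h.conv hφpf hφle
  -- the three polynomials
  set P : ℝ[X] := ∑ j ∈ Finset.range (n + 1), μ j • Polynomial.hasseDeriv j f with hP
  have hPn : P.natDegree ≤ n := natDegree_hasseSum_le hf
  set TP : ℝ[X] := ∑ i ∈ Finset.range (n + 1), c i • Polynomial.hasseDeriv i P with hTP
  have hTPn : TP.natDegree ≤ n := natDegree_hasseSum_le hPn
  -- Hasse expansions
  have hPeval : ∀ y, P.eval y = ∫ t, φ (y - t) * f.eval t := by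
    intro y
    rw [hP, hφpf.eval_hasseSum_eq_integral hμ' hf y,
      ← integral_sub_left_eq_self (fun t => φ (y - t) * f.eval t) volume y]
    congr 1
    funext t
    simp only [sub_sub_cancel]
  have hTPeval : ∀ w, TP.eval w = ∫ r, Λ r * P.eval (w - r) := fun w =>
    h.eval_hasseSum_eq_integral hc hPn w
  have hQeval : (∑ k ∈ Finset.range (n + 1), μ k • Polynomial.hasseDeriv k TP).eval x =
      ∫ s, φ s * TP.eval (x - s) := hφpf.eval_hasseSum_eq_integral hμ' hTPn x
  -- decay data
  obtain ⟨ηΛ, hηΛ, CΛ, -, hΛdec⟩ := h.exists_exp_decay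
  obtain ⟨ηH, hηH, CH, -, hHdec⟩ := hHpf.exists_exp_decay
  set δ := min ηΛ ηH / 2 with hδ
  have hδ0 : 0 < δ := by
    rw [hδ]
    exact half_pos (lt_min hηΛ hηH)
  have hδΛ : δ < ηΛ := by
    rw [hδ]
    linarith [min_le_left ηΛ ηH]
  have hδH : δ < ηH := by
    rw [hδ]
    linarith [min_le_right ηΛ ηH]
  obtain ⟨A, hA0, hA⟩ := exists_abs_eval_le_exp f hδ0
  have hIφ : Integrable fun w => φ w * Real.exp (δ * |w|) := integrable_gaussian_mul_exp_abs ha δ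
  have hIΛ : Integrable fun w => Λ w * Real.exp (δ * |w|) :=
    integrable_mul_exp_abs_of_decay h.measurable h.nonneg hΛdec hδΛ
  have hIH : Integrable fun w => H w * Real.exp (δ * |w|) :=
    integrable_mul_exp_abs_of_decay hHpf.measurable hHpf.nonneg hHdec hδH
  have hfm : Measurable fun t => f.eval t := (Polynomial.continuous f).measurable
  -- Fubini #1: `∫ K(x-t) f(t) = ∫ φ(s) ∫ H(x-s-t) f(t)`
  have hF1 := (integral_conv_mul_eq hφpf.measurable hHpf.measurable hfm hφpf.nonneg hHpf.nonneg
    hδ0.le hA hIφ hIH x).2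
  -- Fubini #2: `∫ H(y-t) f(t) = ∫ Λ(r) ∫ φ(y-r-t) f(t)`
  have hF2 : ∀ y, ∫ t, H (y - t) * f.eval t = ∫ r, Λ r * ∫ t, φ (y - r - t) * f.eval t := by
    intro y
    have h2 := (integral_conv_mul_eq h.measurable hφpf.measurable hfm h.nonneg hφpf.nonneg
      hδ0.le hA hIΛ hIφ y).2
    rw [← h2]
  -- assemble
  show ∫ t, (∫ t', φ t' * H (x - t - t')) * f.eval t = _
  rw [hF1, hQeval]
  congr 1
  funext s
  congr 1
  rw [hF2 (x - s), hTPeval (x - s)]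
  congr 1
  funext r
  rw [hPeval (x - s - r)]

/-! ### The variation diminishing property of the transform on polynomials -/

/-- **`Λ ⋆` is variation diminishing on polynomials** (Schoenberg): for a Pólya frequency function
`Λ`, a real polynomial `f` (`deg f ≤ n`) all of whose real roots lie among `r₀ < ⋯ < r_{m−1}`, and
`T f = Σ_{k≤n} c_k H_k f` (`c_k = ∫ (−t)^k Λ`), the values of `T f` at `m + 2` strictly
increasing points never alternate strictly in sign.  Smoothing + variation diminishing property of
the strictly totally positive kernels `φ_a ⋆ Λ ⋆ φ_a` + the limit `a → ∞` of the normalised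
Gaussian moments. [cite: Schoenberg1951, §§7–8] [cite: Karlin1968, Ch. 5 §1] -/
theorem IsPolyaFrequencyFun.no_alternation_hasseSum {Λ : ℝ → ℝ} (h : IsPolyaFrequencyFun Λ)
    {c : ℕ → ℝ} (hc : ∀ k, c k = ∫ t, (-t) ^ k * Λ t) {n : ℕ} {f : ℝ[X]} (hf : f.natDegree ≤ n)
    {m : ℕ} {r : Fin m → ℝ} (hr : StrictMono r) (hroots : ∀ t : ℝ, f.eval t = 0 → t ∈ Set.range r)
    {z : Fin (m + 2) → ℝ} (hz : StrictMono z) :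
    ¬ ∀ i : Fin (m + 1),
      (∑ k ∈ Finset.range (n + 1), c k • Polynomial.hasseDeriv k f).eval (z i.castSucc) *
        (∑ k ∈ Finset.range (n + 1), c k • Polynomial.hasseDeriv k f).eval (z i.succ) < 0 := by
  classical
  intro halt
  set T : ℝ[X] → ℝ[X] := fun g => ∑ k ∈ Finset.range (n + 1), c k • Polynomial.hasseDeriv k g
    with hT
  -- signs of `f` on the blocks
  have hsign' : ∀ j : Fin (m + 1), ∃ ε : ℝ, (ε = 1 ∨ ε = -1) ∧ ∀ t : ℝ,
      (∀ k : Fin m, ((k : ℕ) < (j : ℕ) → r k < t) ∧ ((j : ℕ) ≤ (k : ℕ) → t < r k)) → 0 < ε * f.eval t :=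
    fun j => exists_sign_on_block f hr hroots (Nat.le_of_lt_succ j.2)
  choose ε hε hsign using hsign'
  -- Gaussian moments
  set μ : ℝ → ℕ → ℝ := fun a k => ∫ s, (-s) ^ k * Real.exp (-a * s ^ 2) with hμ
  set ν : ℝ → ℕ → ℝ := fun a k => μ a k / μ a 0 with hν
  have hμ0 : ∀ a, μ a 0 = Real.sqrt (Real.pi / a) := fun a => integral_pow_zero_gaussian a
  have hμpos : ∀ a, 0 < a → 0 < μ a 0 := fun a ha => by
    rw [hμ0]
    exact Real.sqrt_pos.2 (div_pos Real.pi_pos ha)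
  have hμν : ∀ a, 0 < a → ∀ k, μ a k = μ a 0 * ν a k := fun a ha k => by
    have hne : μ a 0 ≠ 0 := (hμpos a ha).ne'
    rw [hν]
    field_simp
  -- the normalised smoothed transform as a polynomial
  set R : ℝ → ℝ[X] := fun a => ∑ k ∈ Finset.range (n + 1), ν a k • Polynomial.hasseDeriv k
    (T (∑ j ∈ Finset.range (n + 1), ν a j • Polynomial.hasseDeriv j f)) with hR
  -- (1) `∫ K_a(x − t) f(t) dt = μ_0(a)² R_a(x)`
  have hga : ∀ a, 0 < a → ∀ x, ∫ t, (fun u => ∫ t', Real.exp (-a * t' ^ 2) *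
      (fun v => ∫ r', Λ r' * Real.exp (-a * (v - r') ^ 2)) (u - t')) (x - t) * f.eval t =
      μ a 0 ^ 2 * (R a).eval x := by
    intro a ha x
    rw [h.smoothing_transform_eval hc ha (μ := μ a) (fun k => rfl) hf x]
    set Pt : ℝ[X] := ∑ j ∈ Finset.range (n + 1), ν a j • Polynomial.hasseDeriv j f with hPt
    have e1 : (∑ j ∈ Finset.range (n + 1), μ a j • Polynomial.hasseDeriv j f) = μ a 0 • Pt := by
      rw [hPt, ← hasseSum_smul_left]
      exact Finset.sum_congr rfl fun j _ => by rw [hμν a ha j]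
    have e2 : (∑ i ∈ Finset.range (n + 1), c i • Polynomial.hasseDeriv i (μ a 0 • Pt)) =
        μ a 0 • T Pt := hasseSum_smul_right c n (μ a 0) Pt
    have e3 : (∑ k ∈ Finset.range (n + 1), μ a k • Polynomial.hasseDeriv k (μ a 0 • T Pt)) =
        μ a 0 • (μ a 0 • ∑ k ∈ Finset.range (n + 1), ν a k • Polynomial.hasseDeriv k (T Pt)) := by
      rw [hasseSum_smul_right, ← hasseSum_smul_left (ν a)]
      congr 1
      exact Finset.sum_congr rfl fun k _ => by rw [hμν a ha k]
    rw [e1, e2, e3, Polynomial.eval_smul, Polynomial.eval_smul, smul_eq_mul, smul_eq_mul, hR]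
    ring
  -- (2) the limit `a → ∞`
  have hνlim : ∀ k, Tendsto (fun a => ν a k) atTop (𝓝 (if k = 0 then (1 : ℝ) else 0)) := by
    intro k
    by_cases hk : k = 0
    · subst hk
      simp only [if_true]
      refine tendsto_const_nhds.congr' ?_
      filter_upwards [eventually_gt_atTop (0 : ℝ)] with a ha
      rw [hν]
      simp only
      rw [div_self (hμpos a ha).ne']
    · rw [if_neg hk]
      exact tendsto_gaussian_moment_ratio (Nat.one_le_iff_ne_zero.2 hk)
  have hReval : ∀ a x, (R a).eval x = ∑ k ∈ Finset.range (n + 1), ∑ j ∈ Finset.range (n + 1),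
      ν a k * ν a j * (Polynomial.hasseDeriv k (T (Polynomial.hasseDeriv j f))).eval x := by
    intro a x
    have hlin : ∀ k, Polynomial.hasseDeriv k (T (∑ j ∈ Finset.range (n + 1),
        ν a j • Polynomial.hasseDeriv j f)) =
        ∑ j ∈ Finset.range (n + 1), ν a j • Polynomial.hasseDeriv k (T (Polynomial.hasseDeriv j f)) := by
      intro k
      rw [hT]
      simp only [map_sum, LinearMap.map_smul_of_tower, Finset.smul_sum]
      rw [Finset.sum_comm]
      refine Finset.sum_congr rfl fun j _ => Finset.sum_congr rfl fun i _ => ?_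
      rw [smul_comm]
    rw [hR]
    simp only [Polynomial.eval_finsetSum, Polynomial.eval_smul, smul_eq_mul]
    refine Finset.sum_congr rfl fun k _ => ?_
    rw [hlin k, Polynomial.eval_finsetSum, Finset.mul_sum]
    refine Finset.sum_congr rfl fun j _ => ?_
    rw [Polynomial.eval_smul, smul_eq_mul]
    ring
  have hRlim : ∀ x, Tendsto (fun a => (R a).eval x) atTop (𝓝 ((T f).eval x)) := by
    intro x
    simp only [hReval]
    have hlim := tendsto_finsetSum (Finset.range (n + 1)) fun k _ =>
      tendsto_finsetSum (Finset.range (n + 1)) fun j _ =>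
        ((hνlim k).mul (hνlim j)).mul_const ((Polynomial.hasseDeriv k (T (Polynomial.hasseDeriv j f))).eval x)
    have hval : ∑ k ∈ Finset.range (n + 1), ∑ j ∈ Finset.range (n + 1),
        (if k = 0 then (1 : ℝ) else 0) * (if j = 0 then (1 : ℝ) else 0) *
          (Polynomial.hasseDeriv k (T (Polynomial.hasseDeriv j f))).eval x = (T f).eval x := by
      simp [Finset.sum_ite_eq', Finset.mem_range, ite_mul]
    rw [← hval]
    exact hlim
  -- (3) a strict alternation of `T f` is inherited for large `a`
  have hprod : ∀ i : Fin (m + 1), Tendsto (fun a => (R a).eval (z i.castSucc) * (R a).eval (z i.succ))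
      atTop (𝓝 ((T f).eval (z i.castSucc) * (T f).eval (z i.succ))) := fun i =>
    (hRlim _).mul (hRlim _)
  have hev : ∀ᶠ a in atTop, ∀ i : Fin (m + 1), (R a).eval (z i.castSucc) * (R a).eval (z i.succ) < 0 :=
    eventually_all.2 fun i => (hprod i).eventually (Iio_mem_nhds (halt i))
  obtain ⟨a, ha, hRa⟩ := ((eventually_gt_atTop (0 : ℝ)).and hev).exists
  -- contradiction with the variation diminishing property of the smoothed kernel
  have hK := no_alternation_of_strict_tp
    (K := fun u => ∫ t', Real.exp (-a * t' ^ 2) *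
      (fun v => ∫ r', Λ r' * Real.exp (-a * (v - r') ^ 2)) (u - t'))
    (f := fun t => f.eval t) (h.smoothing ha).nonneg
    (fun n' x' y' hx' hy' => h.translationMinor_smoothing_pos ha hx' hy')
    (fun c' => (h.smoothing ha).integrable_mul_polynomial f c') hr hε hsign hz
  apply hK
  intro i
  rw [hga a ha, hga a ha]
  have h2 : 0 < μ a 0 ^ 2 := pow_pos (hμpos a ha) 2
  have h3 := hRa i
  nlinarith [mul_pos h2 h2]

end Literature.Analysis.TotalPositivity

end
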